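import Summits.QuantumFields.BalabanUV.T4Continuum.Spine.NE1p.DressedSmallFieldMixedDerivativeLetter
import Summits.QuantumFields.BalabanUV.T4Continuum.Spine.NE1p.DressedSmallFieldMixedLetterLocal

/-!
# T⁴ programme, spine estimate NE1′ (node O3b/H2) — THE INNER CONTOURS ARE THE MIXED DECOUPLING DERIVATIVE ON PRINT's ANALYTICITY DOMAIN
# (the LOCAL version of W55): the angular letter reproduces Dimock's `∂_{enumS S} F (basePt S s)` for a factor JOINTLY ANALYTIC ON AN OPEN
# POLYDISC `Π_j {|σ_j| < R_j}`, `R_j > r_j`, ONLY — print's TYPE «analytic … for |s(Y₀)| ≤ e^{κ₁}» (a neighbourhood of the closed polydisc),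
# not entire; W43 was this step for the DIFFERENCE letter, this file is it for the DERIVATIVE letter

Cell `pub-balaban`, sub-cell `t4`, row NE1′ formalisation crew (`t4/formal/NE1p/LEAVES.md` row W57 ∕ DAG N29zzzc, BOOKED typer R-T132 on INTENT
l.20657; follower of the unit's own W55, whose typer condition (η) recorded the LOCAL version as «NOT claimed» there), unit
`b2b-balaban-t4-ne1p-formalise-leaf-08` (gen 11).  ADDITIVE — imports W55 PART 2 `Spine/NE1p/DressedSmallFieldMixedDerivativeLetter` and W43
`Spine/NE1p/DressedSmallFieldMixedLetterLocal` (`continuous_σS`, `σS_mem_pi`, `norm_σc_lt`, `mapsTo_cons_right` BY NAME) ONLY; THEOREMS ONLY (0 def,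
0 `def … : Prop`, 0 cite, 0 sorry, 0 `attribute`) + 2 `example`s; nothing of W55 ∕ W43 ∕ W39.1 ∕ the substrate ∕ the Literature module restated.

WHY THIS FILE.  [Balaban1988RGII] p. 6 (last paragraph): the expression under the decoupling operators is «an analytic function of s(Y₀), B,
for |s(Y₀)| ≤ e^{κ₁}»; p. 7 (1.23) «the σ(Δ)-integrations are over the circles |σ(Δ)| = e^{κ₁}»; p. 15 «… analytic function … of the complex
parameters σ(Z), τ» — LOCI of the audited manuscript, TYPE∕CONTEXT only: print's TYPE is analyticity near the CLOSED polydisc, not on `ℂⁿ`.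
W55 PART 2 `mixedDerivLetter_rep` assumed `AnalyticOnNhd ℂ F univ`; here the hypothesis is `AnalyticOnNhd ℂ F (Π_j {|σ_j| < R_j})`, `R_j > r_j`.
§1 local bridge (`isOpen_polyBall`, `analyticOnNhd_cons_right`, `analyticOnNhd_cons_section_local`, `basePt_mem_pi`,
**`differentiableOn_mixedDeriv_cons`** = Dimock's `analyticOnNhd_mixedDeriv` on the OPEN polydisc + W55's `mixedDeriv_map_succ_cons` + W39.1's
`differentiable_cons_left`, BY NAME; `continuous_pairθ`); §2 **`mixedDerivLetter_rep_local`** (W55's `Fin.cons` induction with W43's locality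
plumbing; the substrate's `setIntegral_w₁_mul_eq_deriv` ONCE at `isOpen_ball`∕`closedBall_subset_ball (hR 0)` — locality non-idle), the
`example` recovering W55's ENTIRE statement as the special case `R := r + 1`, `norm_mixedDeriv_enumS_le_letter_local` (the letter's cost);
§3 GENUINE: the decided NON-ENTIRE factor `(4 − z₀z₁)⁻¹` — `analyticOnNhd_inv_four_sub` (radius-2 polydisc), **`not_analyticOnNhd_univ_inv_four_sub`**
(NOT entire: discontinuous at `(2,2)`), and the `example` that §2 FIRES for it at radii `3∕2 < 2`, where W55's entire theorem is silent.

HONEST FRAMING.  [folklore] analysis (as W55 PART 2) on the substrate's CONTOUR OBJECTS with the hypothesis localised to print's TYPE; a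
DICTIONARY∕BRIDGE, not an estimate of print; `F` ↔ print's s(Δ)-dependent operator products and radii ↔ (1.22) are TYPE READINGS; `‖F∘σS‖ ≤ B`
is a HYPOTHESIS ((1.18)∕(1.21) TYPE); the open-polydisc hypothesis is JOINT analyticity (print's word; Mathlib has no Osgood lemma upgrading joint
`DifferentiableOn` on `ℂⁿ` — hence `AnalyticOnNhd`, not W43's `DifferentiableOn`, which sufficed for differences); for the derivative itself
Dimock's `lemma19_cauchy` (Literature, BY NAME in W55 PART 2) is the sharper bound and is NOT re-derived; no numeral of [Balaban1988RGII]
asserted (k2); (B1) for Bałaban's (2.14) NOT discharged; (B3) = GAPS G-ne9p2-5 UNPRINTED — NOT discharged, untouched; (B5) untouched;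
0 binders instantiated on Bałaban's densities ∕ operators ∕ (2.14) data ∕ `d_k` ∕ minimisers ∕ backgrounds; discharges no wall item; wall v1.7
(T4-DAG v47) does NOT move; R-t4r2-Q2 NOT met thereby; NE1′ ⇐ the named binders — NOT proved, NOT printed; spine PROVED 0∕9; count 9
unchanged.  Rung (B)+1 on ONE finite four-torus — NOT infinite volume, NOT a mass gap, NOT OS on ℝ⁴, NOT Clay.  ABSOLUTE RULE honoured: the
quotations are LOCI of the audited manuscript [Balaban1988RGII] (CMP 116 (1988) 1–22, pp. 6, 7, 15), TYPE∕CONTEXT only, never hypothesis-free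
facts; [Dimock2013] enters only through the cite-tagged Literature module BY NAME; nothing internally minted is cited; [folklore] tags on kernel
lemmas only.  HONEST DEPENDENCY: continuum YM on T⁴ ⇐ BetaPertH ∧ nine spine estimates (0/9 proved); BetaPertH ⇐ (D1) ∧ (D4) ∧
CAP+tail; G-an2-4 gates asym, D1 and NE2/3/4.
-/

noncomputable section
namespace Summit.QuantumFields.BalabanUV.T4Continuum.NE1p.DressedSmallFieldMixedDerivativeLetterLocal
open MeasureTheory Metric Set Complex Finset Function
open scoped BigOperators
open Summit.QuantumFields.BalabanUV.T4Continuum.B13TermContours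
open Summit.QuantumFields.BalabanUV.T4Continuum.NE1p.DressedSmallFieldMixedLetter
open Summit.QuantumFields.BalabanUV.T4Continuum.NE1p.DressedSmallFieldMixedLetterLocal (continuous_σS σS_mem_pi norm_σc_lt mapsTo_cons_right)
open Summit.QuantumFields.BalabanUV.T4Continuum.NE1p.DressedSmallFieldMixedDerivativeBridge
open Summit.QuantumFields.BalabanUV.T4Continuum.NE1p.DressedSmallFieldMixedDerivativeLetter
open Literature.MathematicalPhysics.QuantumFieldTheory.Dimock2011to13.PolydiscCauchyBounds (mixedDeriv analyticOnNhd_mixedDeriv)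

variable {n : ℕ}
/-! ## §1 Local bridge: sections and head sections on the OPEN POLYDISC -/

/-- [folklore] The open polydisc `Π_j {|z_j| < R_j}` is open. -/
theorem isOpen_polyBall (R : Fin n → ℝ) : IsOpen (Set.univ.pi fun j : Fin n => ball (0 : ℂ) (R j)) :=
  isOpen_set_pi finite_univ fun _ _ => isOpen_ball

/-- [folklore] The insertion `w ↦ c ∷ w` is jointly analytic (Mathlib `AnalyticOnNhd.pi`). -/
theorem analyticOnNhd_cons_right (c : ℂ) (V : Set (Fin n → ℂ)) :
    AnalyticOnNhd ℂ (fun w : Fin n → ℂ => (Fin.cons c w : Fin (n + 1) → ℂ)) V := by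
  have h : ∀ i : Fin (n + 1), AnalyticOnNhd ℂ (fun w : Fin n → ℂ => (Fin.cons c w : Fin (n + 1) → ℂ) i) V := by
    intro i
    induction i using Fin.cases with
    | zero => simpa using (analyticOnNhd_const : AnalyticOnNhd ℂ (fun _ : Fin n → ℂ => c) V)
    | succ j => simpa using (analyticOnNhd_apply j).mono (subset_univ V)
  exact AnalyticOnNhd.pi h

/-- [folklore] Sections of a function analytic on the open polydisc are analytic on the tail polydisc, for a head value inside its disc. -/
theorem analyticOnNhd_cons_section_local {R : Fin (n + 1) → ℝ} {F : (Fin (n + 1) → ℂ) → ℂ}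
    (hF : AnalyticOnNhd ℂ F (Set.univ.pi fun j => ball (0 : ℂ) (R j))) {c : ℂ} (hc : ‖c‖ < R 0) :
    AnalyticOnNhd ℂ (fun w : Fin n → ℂ => F (Fin.cons c w)) (Set.univ.pi fun j => ball (0 : ℂ) (Fin.tail R j)) :=
  hF.comp (analyticOnNhd_cons_right c _) (mapsTo_cons_right hc)

/-- [folklore] The base point lies in the tail polydisc when `s_j ∈ [0,1]` on the active cubes and the radii exceed `1`. -/
theorem basePt_mem_pi {R : Fin n → ℝ} (hR1 : ∀ j, 1 < R j) (S : Finset (Fin n)) {s : Fin n → ℝ}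
    (hs : ∀ j ∈ S, s j ∈ Icc (0 : ℝ) 1) : basePt S s ∈ Set.univ.pi fun j => ball (0 : ℂ) (R j) := by
  refine Set.mem_univ_pi.2 fun j => mem_ball_zero_iff.2 ?_
  unfold basePt; split_ifs with h
  · rw [Complex.norm_real, Real.norm_of_nonneg (hs j h).1]; exact lt_of_le_of_lt (hs j h).2 (hR1 j)
  · simpa using zero_lt_one.trans (hR1 j)

/-- **THE HEAD SECTION OF `∂_l` IS HOLOMORPHIC ON THE HEAD DISC `|z| < R 0`** for `F` analytic on the open polydisc and a tail point inside the
tail polydisc — Dimock's `analyticOnNhd_mixedDeriv` (OPEN polydisc) + W55's `mixedDeriv_map_succ_cons` + W39.1's `differentiable_cons_left`. [folklore] -/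
theorem differentiableOn_mixedDeriv_cons {R : Fin (n + 1) → ℝ} {F : (Fin (n + 1) → ℂ) → ℂ}
    (hF : AnalyticOnNhd ℂ F (Set.univ.pi fun j => ball (0 : ℂ) (R j))) (l : List (Fin n)) {p : Fin n → ℂ}
    (hp : p ∈ Set.univ.pi fun j => ball (0 : ℂ) (Fin.tail R j)) :
    DifferentiableOn ℂ (fun z : ℂ => mixedDeriv l (fun w => F (Fin.cons z w)) p) (ball (0 : ℂ) (R 0)) := by
  have h : (fun z : ℂ => mixedDeriv l (fun w => F (Fin.cons z w)) p) = fun z => mixedDeriv (l.map Fin.succ) F (Fin.cons z p) := by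
    funext z; rw [mixedDeriv_map_succ_cons]
  rw [h]
  have hA := analyticOnNhd_mixedDeriv (isOpen_polyBall R) hF (l.map Fin.succ)
  intro z hz
  have hmem : (Fin.cons z p : Fin (n + 1) → ℂ) ∈ Set.univ.pi fun j => ball (0 : ℂ) (R j) :=
    mapsTo_cons_right (mem_ball_zero_iff.1 hz) hp
  exact ((hA _ hmem).differentiableAt.comp z (differentiable_cons_left p z)).differentiableWithinAt

/-- [folklore] The configuration map `θ ↦ (s_j, θ_j)_j` is continuous. -/
theorem continuous_pairθ (s : Fin n → ℝ) : Continuous (pairθ s) :=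
  continuous_pi fun j => continuous_const.prodMk (continuous_apply j)

/-! ## §2 THE INNER CONTOURS ARE `∂^S F(s)` FOR A FACTOR ANALYTIC ON PRINT's DOMAIN: an open polydisc `Π{|σ_j| < R_j}`, `R_j > r_j` -/

/-- **THE INNER CONTOURS ARE THE MIXED DECOUPLING DERIVATIVE — LOCAL HYPOTHESIS** (kernel; W55 PART 2's induction with W43's locality plumbing
BY NAME and the substrate's `setIntegral_w₁_mul_eq_deriv` at `isOpen_ball`∕`closedBall_subset_ball`): for radii `1 < r j < R j`, `F` JOINTLY
ANALYTIC ON THE OPEN POLYDISC `Π_j {|σ_j| < R_j}` ONLY (print's TYPE, p. 6 ∕ p. 15) and `s_j ∈ [0,1]` on the active cubes,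
`∫ wS r S (s,θ)·F(σ_S(s,θ)) d(⨂_j θS S j)(θ) = mixedDeriv (enumS S) F (basePt S s)`. [folklore] -/
theorem mixedDerivLetter_rep_local : ∀ (n : ℕ) (r R : Fin n → ℝ) (S : Finset (Fin n)) (F : (Fin n → ℂ) → ℂ) (s : Fin n → ℝ),
    (∀ j, 1 < r j) → (∀ j, r j < R j) → AnalyticOnNhd ℂ F (Set.univ.pi fun j => ball (0 : ℂ) (R j)) →
    (∀ j ∈ S, s j ∈ Icc (0 : ℝ) 1) →
    ∫ θ, wS r S (pairθ s θ) * F (σS r S (pairθ s θ)) ∂(Measure.pi (θS S)) = mixedDeriv (enumS n S) F (basePt S s)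
  | 0, r, R, S, F, s, _, _, _, _ => by
      rw [Measure.pi_of_empty (θS S), integral_dirac, mixedDeriv_enumS_zero]
      have h0 : ∀ p : Fin 0 → ℝ × ℝ, σS r S p = fun i => i.elim0 := fun p => funext fun i => i.elim0
      simp [wS, h0]
  | n + 1, r, R, S, F, s, hr, hR, hF, hs => by
      have hr' : ∀ j, 1 < Fin.tail r j := fun j => hr j.succ
      have hR' : ∀ j, Fin.tail r j < Fin.tail R j := fun j => hR j.succ
      have hr0 : ∀ j, 0 ≤ r j := fun j => zero_le_one.trans (hr j).le
      have hR1 : ∀ j, 1 < R j := fun j => (hr j).trans (hR j)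
      have hs' : ∀ j ∈ tailSet S, Fin.tail s j ∈ Icc (0 : ℝ) 1 := fun j hj => hs j.succ (mem_tailSet.1 hj)
      set G : (Fin (n + 1) → ℝ) → ℂ := fun θ => wS r S (pairθ s θ) * F (σS r S (pairθ s θ)) with hG
      have hFσ : Continuous fun θ : Fin (n + 1) → ℝ => F (σS r S (pairθ s θ)) :=
        hF.continuousOn.comp_continuous ((continuous_σS r S).comp (continuous_pairθ s)) fun θ => σS_mem_pi hr0 hR S _
      have hGm : Measurable G := ((measurable_wS r S).comp (measurable_pairθ s)).mul hFσ.measurable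
      obtain ⟨B, hB⟩ : ∃ B, ∀ p, ‖F (σS r S p)‖ ≤ B := by
        have hK : IsCompact (Set.univ.pi fun j : Fin (n + 1) => closedBall (0 : ℂ) (r j)) :=
          isCompact_univ_pi fun j => isCompact_closedBall _ _
        obtain ⟨B, hB⟩ := hK.exists_bound_of_continuousOn
          (hF.continuousOn.mono (Set.pi_mono fun j _ => closedBall_subset_ball (hR j)))
        exact ⟨B, fun p => hB _ (Set.mem_univ_pi.2 fun j => mem_closedBall_zero_iff.2 (norm_σS_le hr0 S p j))⟩
      have hGb : ∀ θ, ‖G θ‖ ≤ (∏ j, max (wB₁ (r j)) 1) * B := fun θ => by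
        rw [hG]; dsimp only; rw [norm_mul]
        exact mul_le_mul (norm_wS_le hr S _) (hB _) (norm_nonneg _)
          (Finset.prod_nonneg fun _ _ => zero_le_one.trans (le_max_right _ _))
      have hGi : Integrable G (Measure.pi (θS S)) :=
        Integrable.mono' (integrable_const _) hGm.aestronglyMeasurable (Filter.Eventually.of_forall hGb)
      have hmp := (measurePreserving_piFinSuccAbove (θS S) 0).symm
      have hpi : (fun j : Fin n => θS S (Fin.succAbove 0 j)) = θS (tailSet S) := by
        funext j; rw [Fin.succAbove_zero]; exact θS_succ S j
      rw [hpi] at hmp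
      have he : ∀ q : ℝ × (Fin n → ℝ),
          (MeasurableEquiv.piFinSuccAbove (fun _ : Fin (n + 1) => ℝ) 0).symm q = Fin.cons q.1 q.2 := by
        intro q
        simp only [MeasurableEquiv.piFinSuccAbove_symm_apply, Fin.insertNthEquiv, Fin.insertNth_zero, Equiv.coe_fn_mk]
        rfl
      have h1 : ∫ θ, G θ ∂(Measure.pi (θS S)) = ∫ q, G (Fin.cons q.1 q.2) ∂((θS S 0).prod (Measure.pi (θS (tailSet S)))) := by
        rw [← hmp.integral_comp']
        exact integral_congr_ae (Filter.Eventually.of_forall fun q => by dsimp only; rw [he])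
      have hint : Integrable (fun q : ℝ × (Fin n → ℝ) => G (Fin.cons q.1 q.2)) ((θS S 0).prod (Measure.pi (θS (tailSet S)))) :=
        ((hmp.integrable_comp hGi.aestronglyMeasurable).2 hGi).congr
          (Filter.Eventually.of_forall fun q => by simp only [Function.comp_apply, he])
      have hcons : ∀ (x : ℝ) (z : Fin n → ℝ), G (Fin.cons x z) =
          cw r S 0 (s 0, x) * (wS (Fin.tail r) (tailSet S) (pairθ (Fin.tail s) z) *
            F (Fin.cons (σc r S 0 (s 0, x)) (σS (Fin.tail r) (tailSet S) (pairθ (Fin.tail s) z)))) := fun x z => by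
        rw [hG]; dsimp only; rw [pairθ_cons, wS_cons, σS_cons]; ring
      have hinner : ∀ x : ℝ, ∫ z, G (Fin.cons x z) ∂(Measure.pi (θS (tailSet S))) =
          cw r S 0 (s 0, x) *
            mixedDeriv (enumS n (tailSet S)) (fun w => F (Fin.cons (σc r S 0 (s 0, x)) w)) (basePt (tailSet S) (Fin.tail s)) :=
          fun x => by
        simp_rw [hcons]
        rw [integral_const_mul, mixedDerivLetter_rep_local n (Fin.tail r) (Fin.tail R) (tailSet S)
          (fun w => F (Fin.cons (σc r S 0 (s 0, x)) w)) (Fin.tail s) hr' hR'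
          (analyticOnNhd_cons_section_local hF (norm_σc_lt hr0 hR S 0 _)) hs']
      rw [h1, integral_prod _ hint]
      dsimp only
      simp_rw [hinner]
      by_cases h0 : (0 : Fin (n + 1)) ∈ S
      · have hμ0 : θS S 0 = volume.restrict (Icc (0 : ℝ) (2 * Real.pi)) := if_pos h0
        have hcw : ∀ x, cw r S 0 (s 0, x) = w₁ (r 0) (s 0, x) := fun x => if_pos h0
        have hσ : ∀ x : ℝ, σc r S 0 (s 0, x) = circ (r 0) x := fun x => if_pos h0
        have hH : DifferentiableOn ℂ (fun z : ℂ =>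
            mixedDeriv (enumS n (tailSet S)) (fun w => F (Fin.cons z w)) (basePt (tailSet S) (Fin.tail s))) (ball (0 : ℂ) (R 0)) :=
          differentiableOn_mixedDeriv_cons hF _ (basePt_mem_pi (fun j => hR1 j.succ) (tailSet S) hs')
        have key := setIntegral_w₁_mul_eq_deriv (hr 0) isOpen_ball (closedBall_subset_ball (hR 0))
          (F := fun z => mixedDeriv (enumS n (tailSet S)) (fun w => F (Fin.cons z w)) (basePt (tailSet S) (Fin.tail s)))
          hH (hs 0 h0).1 (hs 0 h0).2
        simp_rw [hμ0, hcw, hσ]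
        rw [key, mixedDeriv_enumS_succ_of_mem h0]
      · have hμ0 : θS S 0 = Measure.dirac 0 := if_neg h0
        have hcw : ∀ x, cw r S 0 (s 0, x) = 1 := fun x => if_neg h0
        have hσ : ∀ x : ℝ, σc r S 0 (s 0, x) = 0 := fun x => if_neg h0
        simp_rw [hμ0, hcw, hσ, one_mul]
        rw [integral_dirac, mixedDeriv_enumS_succ_of_not_mem h0]

/-- [folklore] Part 2's ENTIRE case is the special case of any radii `R > r`. -/
example (n : ℕ) (r : Fin n → ℝ) (S : Finset (Fin n)) (F : (Fin n → ℂ) → ℂ) (s : Fin n → ℝ) (hr : ∀ j, 1 < r j)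
    (hF : AnalyticOnNhd ℂ F univ) (hs : ∀ j ∈ S, s j ∈ Icc (0 : ℝ) 1) :
    ∫ θ, wS r S (pairθ s θ) * F (σS r S (pairθ s θ)) ∂(Measure.pi (θS S)) = mixedDeriv (enumS n S) F (basePt S s) :=
  mixedDerivLetter_rep_local n r (fun j => r j + 1) S F s hr (fun j => by linarith) (hF.mono (subset_univ _)) hs

/-- **THE COST, LOCAL HYPOTHESIS**: `‖∂_{enumS S} F (basePt S s)‖ ≤ (Π_{j∈S} r_j∕(r_j−1)²)·B` under a bound `B` on the contour configurations. [folklore] -/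
theorem norm_mixedDeriv_enumS_le_letter_local {r R : Fin n → ℝ} (hr : ∀ j, 1 < r j) (hR : ∀ j, r j < R j) (S : Finset (Fin n))
    {F : (Fin n → ℂ) → ℂ} (hF : AnalyticOnNhd ℂ F (Set.univ.pi fun j => ball (0 : ℂ) (R j))) {B : ℝ}
    (hB : ∀ p, ‖F (σS r S p)‖ ≤ B) {s : Fin n → ℝ} (hs : ∀ j ∈ S, s j ∈ Icc (0 : ℝ) 1) :
    ‖mixedDeriv (enumS n S) F (basePt S s)‖ ≤ (∏ j ∈ S, r j / (r j - 1) ^ 2) * B := by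
  rw [← mixedDerivLetter_rep_local n r R S F s hr hR hF hs]
  exact (norm_integral_le_integral_norm _).trans (mixedDerivLetter_majorant_le hr S s hB)

/-! ## §3 A DECIDED NON-ENTIRE FACTOR: the local theorem fires where W55's entire one cannot -/

/-- [folklore] The decided factor `(4 − z₀z₁)⁻¹` is JOINTLY ANALYTIC on the open polydisc of radius `2` (`|z₀z₁| < 4`; Mathlib `AnalyticAt.inv`). -/
theorem analyticOnNhd_inv_four_sub :
    AnalyticOnNhd ℂ (fun z : Fin 2 → ℂ => (4 - z 0 * z 1)⁻¹) (Set.univ.pi fun _ : Fin 2 => ball (0 : ℂ) 2) := by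
  intro z hz
  have h0 : ‖z 0‖ < 2 := by simpa using (Set.mem_univ_pi.1 hz) 0
  have h1 : ‖z 1‖ < 2 := by simpa using (Set.mem_univ_pi.1 hz) 1
  have hlt : ‖z 0 * z 1‖ < 4 := by
    rw [norm_mul]; nlinarith [norm_nonneg (z 0), norm_nonneg (z 1)]
  have hne : (4 : ℂ) - z 0 * z 1 ≠ 0 := by
    intro h
    have h' : z 0 * z 1 = 4 := (sub_eq_zero.1 h).symm
    rw [h'] at hlt
    norm_num at hlt
  exact (analyticAt_const.sub ((analyticOnNhd_apply 0 z (mem_univ _)).mul (analyticOnNhd_apply 1 z (mem_univ _)))).inv hne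

/-- **… AND IS NOT ENTIRE** [decided toy]: not even continuous at the diagonal point `(2, 2)` (Lean's `0⁻¹ = 0` there; along `(2 − t, 2 − t)`,
`t ↓ 0`, the value `(t(4 − t))⁻¹` exceeds `1`) — so W55 PART 2's entire `mixedDerivLetter_rep` does NOT apply to it, §2 does (next `example`). [folklore] -/
theorem not_analyticOnNhd_univ_inv_four_sub : ¬ AnalyticOnNhd ℂ (fun z : Fin 2 → ℂ => (4 - z 0 * z 1)⁻¹) univ := by
  intro h
  have hcont : ContinuousAt (fun z : Fin 2 → ℂ => (4 - z 0 * z 1)⁻¹) (fun _ => (2 : ℂ)) := (h _ (mem_univ _)).continuousAt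
  rw [Metric.continuousAt_iff] at hcont
  obtain ⟨δ, hδ, hδ'⟩ := hcont 1 one_pos
  set t : ℝ := min (δ / 2) (1 / 4) with ht
  have htpos : 0 < t := by rw [ht]; positivity
  have ht4 : t ≤ 1 / 4 := min_le_right _ _
  have htδ : t ≤ δ / 2 := min_le_left _ _
  have hdist : dist (fun _ : Fin 2 => (2 : ℂ) - (t : ℂ)) (fun _ => (2 : ℂ)) < δ := by
    rw [dist_pi_lt_iff hδ]
    intro _
    rw [dist_eq_norm, sub_sub_cancel_left, norm_neg, Complex.norm_real, Real.norm_of_nonneg htpos.le]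
    linarith
  have h1 := hδ' hdist
  beta_reduce at h1
  have hprod : 0 < t * (4 - t) := mul_pos htpos (by linarith)
  have hval : ((4 : ℂ) - (2 - (t : ℂ)) * (2 - (t : ℂ)))⁻¹ = (((t * (4 - t))⁻¹ : ℝ) : ℂ) := by
    push_cast
    rw [inv_inj]
    ring
  have h0 : ((4 : ℂ) - 2 * 2)⁻¹ = 0 := by norm_num
  rw [hval, h0, dist_zero_right, Complex.norm_real, Real.norm_of_nonneg (inv_pos.2 hprod).le] at h1
  have hle : t * (4 - t) ≤ 1 := by nlinarith
  have : (1 : ℝ) ≤ (t * (4 - t))⁻¹ := (le_inv_comm₀ one_pos hprod).2 (by rwa [inv_one])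
  linarith

/-- DECIDED CHECK: §2 FIRES for the NON-ENTIRE factor `(4 − z₀z₁)⁻¹` at the contour radii `3∕2 < 2` on both cubes — the angular letter at any
`s ∈ [0,1]²` is Dimock's `∂_{[0,1]}` of it at `(s₀, s₁)`; W55's entire theorem is silent here (`not_analyticOnNhd_univ_inv_four_sub`). -/
example (s : Fin 2 → ℝ) (hs : ∀ j, s j ∈ Icc (0 : ℝ) 1) :
    ∫ θ, wS (fun _ => (3 / 2 : ℝ)) {0, 1} (pairθ s θ) *
        (4 - σS (fun _ => (3 / 2 : ℝ)) {0, 1} (pairθ s θ) 0 * σS (fun _ => (3 / 2 : ℝ)) {0, 1} (pairθ s θ) 1)⁻¹ ∂(Measure.pi (θS {0, 1})) =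
      mixedDeriv (enumS 2 {0, 1}) (fun z : Fin 2 → ℂ => (4 - z 0 * z 1)⁻¹) (basePt {0, 1} s) :=
  mixedDerivLetter_rep_local 2 _ (fun _ => 2) {0, 1} (fun z => (4 - z 0 * z 1)⁻¹) s (fun _ => by norm_num) (fun _ => by norm_num)
    analyticOnNhd_inv_four_sub (fun j _ => hs j)

end Summit.QuantumFields.BalabanUV.T4Continuum.NE1p.DressedSmallFieldMixedDerivativeLetterLocal

end
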